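import Summits.ResolutionOfSingularities.ResolutionOfSingularities.Theorems.FrobeniusLadderFInjectiveMacaulayficationTwoRatioDiagonalPair
import Summits.ResolutionOfSingularities.ResolutionOfSingularities.Theorems.FrobeniusLadderFInjectiveMacaulayficationCIClassRowProduct
import Summits.ResolutionOfSingularities.ResolutionOfSingularities.Theorems.FrobeniusLadderFInjectiveMacaulayficationTowerBedChartCM
import Summits.ResolutionOfSingularities.ResolutionOfSingularities.Theorems.FrobeniusLadderFInjectiveMacaulayficationDiagonalBPCIChartsCM
import Summits.ResolutionOfSingularities.ResolutionOfSingularities.Theorems.FrobeniusLadderFInjectiveMacaulayficationDiagonalBPCIVertexNotFull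
import Summits.ResolutionOfSingularities.ResolutionOfSingularities.Theorems.FrobeniusLadderFInjectiveMacaulayficationTwoRatioBPChart5NotFull
import Summits.ResolutionOfSingularities.ResolutionOfSingularities.Theorems.FrobeniusLadderFInjectiveMacaulayficationDiagonalBPCIRow
import Mathlib.FieldTheory.IsAlgClosed.AlgebraicClosure
import HarnessLib

/-!
# (U-B) ★★★ ROW #13 / BED CI-3 — THE FIRST UNEQUAL-SUPPORT (NON-HOMOTHETIC) CI BED: `(x₀²+x₁³+x₂⁵+x₃⁵+x₄⁷+x₅⁷, x₀²+2x₁³+x₂¹⁰+x₃¹⁰+x₄¹⁴+x₅¹⁴) ⊂ 𝔸⁶`, POINT FLOOR CURED (`p ≥ 11`) and INPUT NOT FULL (every `p`)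
# (crux `FInjectiveMacaulayfication` stmt-ResolutionOfSingularities-15315, chain w45a; res-L1-w45a-plan-1 RULINGs R23.25 (β) / R23.28 (2) / R23.29 «BED CI-3 APPROVED … (B) specimen + ROW #13»;
# tri-2 g22 break-test `CI3-BREAKTEST-tri2.md` bf56e1bace93ced6 «sound»; seat res-L1-w45a-stub-2 g13)

[OURS · L1 W4.5a] Support file (`--supports stmt-ResolutionOfSingularities-15315 --as helper`); def-free; UNCONDITIONAL; no named fact, no sorry; a census row is a certificate on ONE bed
and nothing of the crux is proved; NOT a statement of any manuscript; replaces the role of NO printed item. AI-written (AI review weaker than expert review).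

THE BED. `k` ANY field of characteristic `p`; `X = V(F₀, F₁) ⊂ 𝔸⁶_k`, `F₀ = x₀²+x₁³+x₂⁵+x₃⁵+x₄⁷+x₅⁷`, `F₁ = x₀²+2x₁³+x₂¹⁰+x₃¹⁰+x₄¹⁴+x₅¹⁴` — a TWO-RATIO diagonal pair (`bᵢ = aᵢ` on `P = {0,1}`, `bᵢ = 2aᵢ` on
`{2,3,4,5}`): the Newton simplices are NOT homothetic, so neither ✓`CIClassRowEqualSupport` nor ✓`DiagonalCIPair` applies; dimension 4, vertex `v = 0`.
* §1 the data in `Σ`-form, casts, the numerical conditions (P-minor `1·2 − 1·1`, subset sums `|S| < p`);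
* §2 ★ `isPrime_span` — `(F₀, F₁) = (x₀² − G, x₁³ + H)`, `G = Σ_{i≥2}(xᵢ^{2aᵢ} − 2xᵢ^{aᵢ})`, `H = Σ_{i≥2}(xᵢ^{2aᵢ} − xᵢ^{aᵢ})`: ✓`MonicTowerPrime` shape (`G` no square: `x₂ ↦ t` gives `t⁵(t⁵ − 2)` of
  odd TRAILING degree; `−H` no cube: degree `10`);
* §3 ★★★ `twoRatioBP_pointFloorCured` (`p ≥ 11`, `K ⊇ k` algebraically closed): ONE application of ✓`CIClassRowProduct.fHalfRow_CI_of_convenientProduct` (tables for `F₀F₁`, no kit job) with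
  ✓`TwoRatioDiagonalPair.{ciNondegenerate_twoRatio, isRegularLocalRing_off_vertex_twoRatio}`, ✓`DiagonalPairTruncations.mk_X_ne_zero_pair_general`, ✓`CIClassRowProduct.convenient_diag_mul_diag`;
* §4 ★ `twoRatioBP_vertex_not_full` — INPUT COLUMN, EVERY `p` (minimal-weight lemmas of ✓`TwoRatioBPChart5NotFull`): with `w = (105,70,42,42,30,30)` every monomial of `F₀` and of `F₁` has weight `≥ 210`, so `(F₀F₁)^{p−1}` has weights
  `≥ 420(p−1) > 319(p−1) = (p−1)Σwᵢ` and lies in `(xᵢ^p)` (CI Fedder, necessity); s.o.p. `(x)⁴ ⊆ (F₀, F₁, x₂..x₅)`; ✓`CINotFullAtMaximalIdeal.ci_not_fullCl_stalk_origin`;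
* §5 `row13_CI3_germ` — the registrar pairing (¬FULL at `v` ∧ point floor CURED, `K := k̄`).
[cite: IshiiSingularities2018, Thm. 4.4.23] [cite: CuetoPopescupampuStepanov2023, Def. 4.2] [cite: Fedder1983, Thm. 1.12] [cite: StacksProject, Tag 080A]
-/

-- single-problem summit: the doubled namespace component is forced
set_option linter.dupNamespace false

noncomputable section

open AlgebraicGeometry CategoryTheory Literature.AlgebraicGeometry.Resolution TopologicalSpace IsLocalRing MvPolynomial

namespace Summit.ResolutionOfSingularities.ResolutionOfSingularities.Theorems.FInjectiveMacaulayfication.TwoRatioBPCIRow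

open Summit.ResolutionOfSingularities.ResolutionOfSingularities.Theorems.FInjectiveMacaulayfication
open Literature.AlgebraicGeometry.Resolution.BoubakriGreuelMarkwig CINondegenerate SliceableCentre

/-! ## §1 The data -/

section Data

variable (K : Type) [Field K]

/-- The two members in `Σ`-form: exponents `a = (2,3,5,5,7,7)`, `b = (2,3,10,10,14,14)`, coefficients `c ≡ 1`, `d = (1,2,1,1,1,1)`. [plumbing] -/
theorem F_eq_sum (F : Fin 2 → MvPolynomial (Fin 6) K)
    (hF0 : F 0 = X 0 ^ 2 + X 1 ^ 3 + X 2 ^ 5 + X 3 ^ 5 + X 4 ^ 7 + X 5 ^ 7)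
    (hF1 : F 1 = X 0 ^ 2 + C 2 * X 1 ^ 3 + X 2 ^ 10 + X 3 ^ 10 + X 4 ^ 14 + X 5 ^ 14) :
    (F 0 = ∑ i : Fin 6, monomial (Finsupp.single i ((![2, 3, 5, 5, 7, 7] : Fin 6 → ℕ) i)) ((fun _ : Fin 6 => (1 : K)) i)) ∧
    (F 1 = ∑ i : Fin 6, monomial (Finsupp.single i ((![2, 3, 10, 10, 14, 14] : Fin 6 → ℕ) i)) ((![1, 2, 1, 1, 1, 1] : Fin 6 → K) i)) := by
  refine ⟨?_, ?_⟩
  · rw [hF0]; simp only [Fin.sum_univ_six, Matrix.cons_val_zero, Matrix.cons_val_one, Matrix.cons_val, X_pow_eq_monomial]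
  · rw [hF1]; simp only [Fin.sum_univ_six, Matrix.cons_val_zero, Matrix.cons_val_one, Matrix.cons_val, ← C_mul_X_pow_eq_monomial, C_1, one_mul]

/-- Casts and sizes of the exponents (`p ≥ 11`). [plumbing] -/
theorem casts (p : ℕ) [Fact p.Prime] (hp : 11 ≤ p) [CharP K p] :
    (∀ i : Fin 6, (![2, 3, 5, 5, 7, 7] : Fin 6 → ℕ) i ≠ 0 ∧ 2 ≤ (![2, 3, 5, 5, 7, 7] : Fin 6 → ℕ) i ∧ ((((![2, 3, 5, 5, 7, 7] : Fin 6 → ℕ) i : ℕ) : K) ≠ 0)) ∧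
    (∀ i : Fin 6, (![1, 2, 1, 1, 1, 1] : Fin 6 → K) i ≠ 0) ∧ (2 : K) ≠ 0 := by
  have hk : ∀ m : ℕ, 0 < m → m < 11 → (m : K) ≠ 0 := fun m hm hm' => DiagonalBPCIRow.natCast_ne_zero_of_lt p m hm (by omega)
  have h2 : (2 : K) ≠ 0 := by exact_mod_cast hk 2 (by norm_num) (by norm_num)
  refine ⟨fun i => ⟨?_, ?_, ?_⟩, fun i => ?_, h2⟩
  · fin_cases i <;> simp
  · fin_cases i <;> simp
  · fin_cases i <;> [exact hk 2 (by norm_num) (by norm_num); exact hk 3 (by norm_num) (by norm_num); exact hk 5 (by norm_num) (by norm_num);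
      exact hk 5 (by norm_num) (by norm_num); exact hk 7 (by norm_num) (by norm_num); exact hk 7 (by norm_num) (by norm_num)]
  · fin_cases i <;> simp [h2]

/-- The two-ratio shape: `b = a` on `P = {0, 1}`, `b = 2a` off `P`. [plumbing] -/
theorem ratios : (∀ i ∈ ({0, 1} : Finset (Fin 6)), (![2, 3, 10, 10, 14, 14] : Fin 6 → ℕ) i = (![2, 3, 5, 5, 7, 7] : Fin 6 → ℕ) i) ∧
    (∀ i : Fin 6, i ∉ ({0, 1} : Finset (Fin 6)) → (![2, 3, 10, 10, 14, 14] : Fin 6 → ℕ) i = 2 * (![2, 3, 5, 5, 7, 7] : Fin 6 → ℕ) i) := by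
  refine ⟨fun i hi => ?_, fun i hi => ?_⟩
  · fin_cases i <;> simp at hi ⊢
  · fin_cases i <;> simp at hi ⊢

/-- The numerical conditions: the `P`-minor `1·2 − 1·1 ≠ 0` and the subset sums `Σ_S 1²/1 = |S| ≠ 0` (`|S| ≤ 6 < p`). [plumbing] -/
theorem numerics (p : ℕ) [Fact p.Prime] (hp : 11 ≤ p) [CharP K p] :
    (∀ i ∈ ({0, 1} : Finset (Fin 6)), ∀ j ∈ ({0, 1} : Finset (Fin 6)), i ≠ j →
      (fun _ : Fin 6 => (1 : K)) i * (![1, 2, 1, 1, 1, 1] : Fin 6 → K) j ≠ (fun _ : Fin 6 => (1 : K)) j * (![1, 2, 1, 1, 1, 1] : Fin 6 → K) i) ∧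
    (∀ S : Finset (Fin 6), S.Nonempty → (∀ i ∈ S, i ∉ ({0, 1} : Finset (Fin 6))) →
      ∑ i ∈ S, (fun _ : Fin 6 => (1 : K)) i ^ 2 / (![1, 2, 1, 1, 1, 1] : Fin 6 → K) i ≠ 0) := by
  have h21 : (2 : K) ≠ 1 := fun h => one_ne_zero (by linear_combination h)
  refine ⟨fun i hi j hj hij => ?_, fun S hS hSP => ?_⟩
  · simp only [Finset.mem_insert, Finset.mem_singleton] at hi hj
    rcases hi with rfl | rfl <;> rcases hj with rfl | rfl <;> simp at hij ⊢
    all_goals first | exact h21 | exact (Ne.symm h21)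
  · have hterm : ∀ i ∈ S, (fun _ : Fin 6 => (1 : K)) i ^ 2 / (![1, 2, 1, 1, 1, 1] : Fin 6 → K) i = 1 := by
      intro i hi
      have hiP := hSP i hi
      fin_cases i <;> simp at hiP ⊢
    rw [Finset.sum_congr rfl hterm, Finset.sum_const, nsmul_eq_mul, mul_one]
    have hcard : S.card ≤ 6 := le_trans (Finset.card_le_univ S) (by simp)
    exact DiagonalBPCIRow.natCast_ne_zero_of_lt p S.card hS.card_pos (by omega)

end Data

/-! ## §2 ★ `(F₀, F₁)` is prime -/

section Prime

variable (k : Type) [Field k]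

/-- `G = Σ (yᵢ^{2aᵢ} − 2yᵢ^{aᵢ})` is not a square (`2 ≠ 0`; `y₀ ↦ t` gives `t⁵(t⁵ − 2)`, trailing degree `5`). [elementary] -/
theorem no_square_G (h2 : (2 : k) ≠ 0) (y : MvPolynomial (Fin 4) k) :
    y ^ 2 ≠ (X 0 ^ 10 - C 2 * X 0 ^ 5 + (X 1 ^ 10 - C 2 * X 1 ^ 5) + (X 2 ^ 14 - C 2 * X 2 ^ 7) + (X 3 ^ 14 - C 2 * X 3 ^ 7) : MvPolynomial (Fin 4) k) := by
  have hc : (Polynomial.X ^ 5 - Polynomial.C (2 : k)) ≠ 0 := fun h => by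
    have := congrArg (Polynomial.coeff · 0) h
    simp at this
    exact h2 this
  have hq0 : (Polynomial.X ^ 5 - Polynomial.C (2 : k)) * Polynomial.X ^ 5 ≠ 0 := mul_ne_zero hc (pow_ne_zero _ Polynomial.X_ne_zero)
  refine TwoRatioBPChart5NotFull.no_square_of_spec_trailing k _ (MvPolynomial.eval₂Hom (Polynomial.C : k →+* Polynomial k) (![Polynomial.X, 0, 0, 0] : Fin 4 → Polynomial k))
    ((Polynomial.X ^ 5 - Polynomial.C 2) * Polynomial.X ^ 5) ?_ hq0 5 ?_ (by norm_num) y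
  · simp only [map_add, map_sub, map_mul, map_pow, MvPolynomial.eval₂Hom_X', MvPolynomial.eval₂Hom_C, Matrix.cons_val_zero, Matrix.cons_val_one, Matrix.cons_val]
    ring
  · rw [Polynomial.natTrailingDegree_mul_X_pow hc 5, Polynomial.natTrailingDegree_eq_zero_of_constantCoeff_ne_zero]
    intro h
    apply hc
    have h' : Polynomial.constantCoeff (Polynomial.X ^ 5 - Polynomial.C (2 : k)) = -2 := by simp
    rw [h'] at h
    exact (h2 (neg_eq_zero.mp h)).elim

/-- `−H`, `H = Σ (yᵢ^{2aᵢ} − yᵢ^{aᵢ})`, is not a cube (`y₀ ↦ t` gives `t¹⁰ − t⁵`, degree `10`, `3 ∤ 10`). [elementary] -/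
theorem no_cube_H (y : MvPolynomial (Fin 4) k) :
    y ^ 3 + (X 0 ^ 10 - X 0 ^ 5 + (X 1 ^ 10 - X 1 ^ 5) + (X 2 ^ 14 - X 2 ^ 7) + (X 3 ^ 14 - X 3 ^ 7) : MvPolynomial (Fin 4) k) ≠ 0 := by
  refine DiagonalBPCIChartsCM.no_cube_of_spec k _ (MvPolynomial.eval₂Hom (Polynomial.C : k →+* Polynomial k) (![Polynomial.X, 0, 0, 0] : Fin 4 → Polynomial k))
    (Polynomial.X ^ 10 - Polynomial.X ^ 5) ?_ 10 ?_ (by norm_num) y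
  · simp only [map_add, map_sub, map_pow, MvPolynomial.eval₂Hom_X', Matrix.cons_val_zero, Matrix.cons_val_one, Matrix.cons_val]
    ring
  · rw [Polynomial.natDegree_sub_eq_left_of_natDegree_lt] <;> simp

/-- ★ **`(F₀, F₁)` IS PRIME**: `(F₀, F₁) = (2F₀ − F₁, F₁ − F₀) = (x₀² − G, x₁³ + H)` and ✓`MonicTowerPrime.isPrime_span_tower` (via ✓`TowerBedChartCM.isPrime_pair`). [OURS · certificate] -/
theorem isPrime_span (h2 : (2 : k) ≠ 0) (F : Fin 2 → MvPolynomial (Fin 6) k)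
    (hF0 : F 0 = X 0 ^ 2 + X 1 ^ 3 + X 2 ^ 5 + X 3 ^ 5 + X 4 ^ 7 + X 5 ^ 7)
    (hF1 : F 1 = X 0 ^ 2 + C 2 * X 1 ^ 3 + X 2 ^ 10 + X 3 ^ 10 + X 4 ^ 14 + X 5 ^ 14) : (Ideal.span (Set.range F)).IsPrime := by
  obtain ⟨g, hg⟩ : ∃ g : Fin 2 → MvPolynomial (Fin 6) k, g = ![C 2 * F 0 - F 1, F 1 - F 0] := ⟨_, rfl⟩
  have hg0 : g 0 = (X 0 : MvPolynomial (Fin 6) k) ^ 2 - MvPolynomial.eval₂Hom MvPolynomial.C ![MvPolynomial.X 2, MvPolynomial.X 3, MvPolynomial.X 4, MvPolynomial.X 5]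
      (X 0 ^ 10 - C 2 * X 0 ^ 5 + (X 1 ^ 10 - C 2 * X 1 ^ 5) + (X 2 ^ 14 - C 2 * X 2 ^ 7) + (X 3 ^ 14 - C 2 * X 3 ^ 7) : MvPolynomial (Fin 4) k) := by
    rw [hg, Matrix.cons_val_zero, hF0, hF1]
    simp only [map_add, map_sub, map_mul, map_pow, MvPolynomial.eval₂Hom_X', Matrix.cons_val_zero, Matrix.cons_val_one, Matrix.cons_val, map_ofNat]
    ring
  have hg1 : g 1 = (X 1 : MvPolynomial (Fin 6) k) ^ 3 + MvPolynomial.eval₂Hom MvPolynomial.C ![MvPolynomial.X 2, MvPolynomial.X 3, MvPolynomial.X 4, MvPolynomial.X 5]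
      (X 0 ^ 10 - X 0 ^ 5 + (X 1 ^ 10 - X 1 ^ 5) + (X 2 ^ 14 - X 2 ^ 7) + (X 3 ^ 14 - X 3 ^ 7) : MvPolynomial (Fin 4) k) := by
    rw [hg, Matrix.cons_val_one, Matrix.cons_val_zero, hF0, hF1]
    simp only [map_add, map_sub, map_pow, MvPolynomial.eval₂Hom_X', Matrix.cons_val_zero, Matrix.cons_val_one, Matrix.cons_val, map_ofNat]
    ring
  have hFg : Ideal.span (Set.range F) = Ideal.span (Set.range g) := by
    rw [TowerBedChartCM.range_fin_two, TowerBedChartCM.range_fin_two]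
    apply le_antisymm
    · rw [Ideal.span_le]
      rintro x (rfl | rfl)
      · exact Ideal.mem_span_pair.mpr ⟨1, 1, by rw [hg]; simp only [Matrix.cons_val_zero, Matrix.cons_val_one, map_ofNat]; ring⟩
      · exact Ideal.mem_span_pair.mpr ⟨1, 2, by rw [hg]; simp only [Matrix.cons_val_zero, Matrix.cons_val_one, map_ofNat]; ring⟩
    · rw [Ideal.span_le]
      rintro x (rfl | rfl)
      · exact Ideal.mem_span_pair.mpr ⟨C 2, -1, by rw [hg]; simp only [Matrix.cons_val_zero]; ring⟩
      · exact Ideal.mem_span_pair.mpr ⟨-1, 1, by rw [hg]; simp only [Matrix.cons_val_zero, Matrix.cons_val_one]; ring⟩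
  rw [hFg]
  exact (TowerBedChartCM.isPrime_pair k _ _ (no_square_G k h2) (no_cube_H k) g hg0 hg1 2 0 rfl).1

end Prime

/-! ## §3 ★★★ The point floor of BED CI-3 is CURED -/

set_option maxHeartbeats 1600000 in
-- the interface of the class theorem is large; the certificates are assembled in one term
/-- ★★★ **BED CI-3 — THE UNEQUAL-SUPPORT TWO-RATIO PAIR IN `𝔸⁶` (dim 4), `char k = p ≥ 11`, `k` ANY FIELD: POINT FLOOR CURED** (product-trick class row; no kit job).
[OURS · census row over the unconditional CI class theorem; cite: IshiiSingularities2018, Thm. 4.4.23; CuetoPopescupampuStepanov2023, Def. 4.2; StacksProject, Tag 080A] -/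
theorem twoRatioBP_pointFloorCured (p : ℕ) [Fact p.Prime] (hp : 11 ≤ p) (k : Type) [Field k] [CharP k p] (K : Type) [Field K] [Algebra k K] [IsAlgClosed K]
    (F : Fin 2 → MvPolynomial (Fin 6) k)
    (hF0 : F 0 = X 0 ^ 2 + X 1 ^ 3 + X 2 ^ 5 + X 3 ^ 5 + X 4 ^ 7 + X 5 ^ 7)
    (hF1 : F 1 = X 0 ^ 2 + C 2 * X 1 ^ 3 + X 2 ^ 10 + X 3 ^ 10 + X 4 ^ 14 + X 5 ^ 14)
    (v : Spec (.of (MvPolynomial (Fin 6) k ⧸ Ideal.span (Set.range F))))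
    (hvm : v.asIdeal = Ideal.span (Set.range fun j : Fin 6 => Ideal.Quotient.mk (Ideal.span (Set.range F)) (X j))) :
    ∀ (S' : Scheme.{0}) (gS : S' ⟶ Spec ((Spec (.of (MvPolynomial (Fin 6) k ⧸ Ideal.span (Set.range F)))).presheaf.stalk v)),
      IsBlowup gS ((affineBlowup.idealSheaf (Ideal.span (Set.range fun j : Fin 6 => Ideal.Quotient.mk (Ideal.span (Set.range F)) (X j)))).comap
        ((Spec (.of (MvPolynomial (Fin 6) k ⧸ Ideal.span (Set.range F)))).fromSpecStalk v)) →
      ∃ 𝓚 : S'.IdealSheafData, 𝓚 ≠ ⊥ ∧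
        (∀ s ∈ (𝓚.support : Set S'), gS.base s = closedPoint ((Spec (.of (MvPolynomial (Fin 6) k ⧸ Ideal.span (Set.range F)))).presheaf.stalk v)) ∧
        ∀ (S'' : Scheme.{0}) (π : S'' ⟶ S'), IsBlowup π 𝓚 → ∀ s : S'', FullCl p (S''.presheaf.stalk s) := by
  classical
  haveI : CharP K p := charP_of_injective_algebraMap (algebraMap k K).injective p
  obtain ⟨hak, hdk, h2k⟩ := casts k p hp
  obtain ⟨haK, hdK, h2K⟩ := casts K p hp
  obtain ⟨hF0', hF1'⟩ := F_eq_sum k F hF0 hF1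
  obtain ⟨hbP, hbQ⟩ := ratios
  obtain ⟨hminork, hsumk⟩ := numerics k p hp
  obtain ⟨hminorK, hsumK⟩ := numerics K p hp
  set a : Fin 6 → ℕ := ![2, 3, 5, 5, 7, 7] with ha_def
  set b : Fin 6 → ℕ := ![2, 3, 10, 10, 14, 14] with hb_def
  have ha : ∀ i, a i ≠ 0 := fun i => (hak i).1
  have ha2 : ∀ i, 2 ≤ a i := fun i => (hak i).2.1
  have hb : ∀ i, b i ≠ 0 := fun i => by have := TwoRatioDiagonalPair.le_b _ a b hbP hbQ i; have := ha i; omega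
  have hb2 : ∀ i, 2 ≤ b i := fun i => le_trans (ha2 i) (TwoRatioDiagonalPair.le_b _ a b hbP hbQ i)
  have hc : ∀ i : Fin 6, (fun _ : Fin 6 => (1 : k)) i ≠ 0 := fun _ => one_ne_zero
  have hcK : ∀ i : Fin 6, (fun _ : Fin 6 => (1 : K)) i ≠ 0 := fun _ => one_ne_zero
  -- base change to `K`
  have hmap0 : map (algebraMap k K) (F 0) = ∑ i : Fin 6, monomial (Finsupp.single i (a i)) ((fun _ : Fin 6 => (1 : K)) i) := by
    rw [hF0', DiagonalCIPair.map_diag]; simp only [map_one]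
  have hmap1 : map (algebraMap k K) (F 1) = ∑ i : Fin 6, monomial (Finsupp.single i (b i)) ((![1, 2, 1, 1, 1, 1] : Fin 6 → K) i) := by
    rw [hF1', DiagonalCIPair.map_diag]
    refine Finset.sum_congr rfl fun i _ => ?_
    fin_cases i <;> simp [map_ofNat]
  -- the class hypotheses
  have hprime : (Ideal.span (Set.range F)).IsPrime := isPrime_span k h2k F hF0 hF1
  have hconv : ∀ j : Fin 6, ∃ N : ℕ, 0 < N ∧ MvPolynomial.coeff (Finsupp.single j N) (∏ l, F l) ≠ 0 :=
    CIClassRowProduct.convenient_diag_mul_diag a b ha hb _ _ hc hdk F hF0' hF1'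
  have hND : ∀ w : Fin 6 → ℝ, (∀ i, 0 < w i) →
      IsCINondegenerateAlong w (fun l => ((map (algebraMap k K) (F l) : MvPolynomial (Fin 6) K) : MvPowerSeries (Fin 6) K)) :=
    TwoRatioDiagonalPair.ciNondegenerate_twoRatio (by norm_num) _ a b hbP hbQ ha (fun i => (haK i).2.2) h2K _ _ hcK hdK hminorK hsumK
      (fun l => map (algebraMap k K) (F l)) hmap0 hmap1
  have hXne : ∀ v : Fin 6, Ideal.Quotient.mk (Ideal.span (Set.range F)) (X v) ≠ 0 :=
    DiagonalPairTruncations.mk_X_ne_zero_pair_general a b ha2 hb2 _ _ F hF0' hF1'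
  have hreg : ∀ x : Spec (.of (MvPolynomial (Fin 6) k ⧸ Ideal.span (Set.range F))),
      ¬ Ideal.span (Set.range fun j : Fin 6 => Ideal.Quotient.mk (Ideal.span (Set.range F)) (X j)) ≤ x.asIdeal →
        IsRegularLocalRing (Localization.AtPrime x.asIdeal) :=
    fun x hx => TwoRatioDiagonalPair.isRegularLocalRing_off_vertex_twoRatio p _ a b hbP hbQ ha2 (fun i => (hak i).2.2) h2k _ _ hc hdk hminork hsumk F hF0' hF1'
      x.asIdeal hx
  exact CIClassRowProduct.fHalfRow_CI_of_convenientProduct p k K (by norm_num) F hprime hconv hND hXne hreg v hvm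

/-! ## §4 ★ The vertex is NOT FULL, for every prime (minimal-weight CI Fedder certificate) -/

section Fedder

variable (k : Type) [Field k]


/-- ★ **THE p-UNIFORM CI FEDDER CERTIFICATE OF THE VERTEX**: `(F₀F₁)^{p−1} ∈ (x₀^p, …, x₅^p)` for EVERY `p ≥ 2` — weights `w = (105,70,42,42,30,30)`: every monomial of `F₀`, `F₁` weighs
`≥ 210`, so `(F₀F₁)^{p−1}` weighs `≥ 420(p−1) > 319(p−1) = (p−1)Σwᵢ`. [OURS · certificate; cite: Fedder1983, Prop. 2.1] -/
theorem prod_pow_mem_span_X_pow (F : Fin 2 → MvPolynomial (Fin 6) k)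
    (hF0 : F 0 = X 0 ^ 2 + X 1 ^ 3 + X 2 ^ 5 + X 3 ^ 5 + X 4 ^ 7 + X 5 ^ 7)
    (hF1 : F 1 = X 0 ^ 2 + C 2 * X 1 ^ 3 + X 2 ^ 10 + X 3 ^ 10 + X 4 ^ 14 + X 5 ^ 14) (p : ℕ) (hp : 2 ≤ p) :
    (F 0 * F 1) ^ (p - 1) ∈ Ideal.span (Set.range fun i : Fin 6 => (X i : MvPolynomial (Fin 6) k) ^ p) := by
  obtain ⟨hF0', hF1'⟩ := F_eq_sum k F hF0 hF1
  have h0 : ∀ m ∈ (F 0).support, 210 ≤ Finsupp.weight (![105, 70, 42, 42, 30, 30] : Fin 6 → ℕ) m := by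
    rw [hF0']
    exact TwoRatioBPChart5NotFull.le_weight_of_mem_support_diag k _ _ _ 210 fun i => by fin_cases i <;> decide
  have h1 : ∀ m ∈ (F 1).support, 210 ≤ Finsupp.weight (![105, 70, 42, 42, 30, 30] : Fin 6 → ℕ) m := by
    rw [hF1']
    exact TwoRatioBPChart5NotFull.le_weight_of_mem_support_diag k _ _ _ 210 fun i => by fin_cases i <;> decide
  have hprod := TwoRatioBPChart5NotFull.le_weight_of_mem_support_pow k _ (F 0 * F 1) 420 (TwoRatioBPChart5NotFull.le_weight_of_mem_support_mul k _ (F 0) (F 1) 210 210 h0 h1) (p - 1)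
  refine TwoRatioBPChart5NotFull.mem_span_X_pow_of_le_weight k p _ _ ((p - 1) * 420) hprod ?_
  have hsum : ∑ i : Fin 6, (![105, 70, 42, 42, 30, 30] : Fin 6 → ℕ) i = 319 := by decide
  rw [hsum]
  have : 1 ≤ p - 1 := by omega
  nlinarith

/-- ★ **THE S.O.P. CERTIFICATE**: `(x₀, …, x₅)⁴ ⊆ (F₀, F₁, x₂, x₃, x₄, x₅)` (`x₁³ = F₁ − F₀ − Σ_{i≥2}(xᵢ^{2aᵢ} − xᵢ^{aᵢ})`, `x₀² = F₀ − x₁³ − Σ_{i≥2} xᵢ^{aᵢ}`). No hypothesis on `p`.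
[OURS · certificate; folklore] -/
theorem sop_certificate (F : Fin 2 → MvPolynomial (Fin 6) k)
    (hF0 : F 0 = X 0 ^ 2 + X 1 ^ 3 + X 2 ^ 5 + X 3 ^ 5 + X 4 ^ 7 + X 5 ^ 7)
    (hF1 : F 1 = X 0 ^ 2 + C 2 * X 1 ^ 3 + X 2 ^ 10 + X 3 ^ 10 + X 4 ^ 14 + X 5 ^ 14) :
    Ideal.span (Set.range (X : Fin 6 → MvPolynomial (Fin 6) k)) ^ 4 ≤ Ideal.ofList (List.ofFn F ++ [X 2, X 3, X 4, X 5]) := by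
  set J : Ideal (MvPolynomial (Fin 6) k) := Ideal.ofList (List.ofFn F ++ [X 2, X 3, X 4, X 5]) with hJ
  have hmem : ∀ x ∈ List.ofFn F ++ [X 2, X 3, X 4, X 5], x ∈ J := fun x hx => Ideal.subset_span hx
  have hF0J : F 0 ∈ J := hmem _ (List.mem_append.mpr (Or.inl ((List.mem_ofFn' _ _).mpr ⟨0, rfl⟩)))
  have hF1J : F 1 ∈ J := hmem _ (List.mem_append.mpr (Or.inl ((List.mem_ofFn' _ _).mpr ⟨1, rfl⟩)))
  have hX2 : (X 2 : MvPolynomial (Fin 6) k) ∈ J := hmem _ (by simp)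
  have hX3 : (X 3 : MvPolynomial (Fin 6) k) ∈ J := hmem _ (by simp)
  have hX4 : (X 4 : MvPolynomial (Fin 6) k) ∈ J := hmem _ (by simp)
  have hX5 : (X 5 : MvPolynomial (Fin 6) k) ∈ J := hmem _ (by simp)
  have hX1 : (X 1 : MvPolynomial (Fin 6) k) ^ 3 ∈ J := by
    have e : (X 1 : MvPolynomial (Fin 6) k) ^ 3 =
        F 1 - F 0 - (X 2 ^ 9 - X 2 ^ 4) * X 2 - (X 3 ^ 9 - X 3 ^ 4) * X 3 - (X 4 ^ 13 - X 4 ^ 6) * X 4 - (X 5 ^ 13 - X 5 ^ 6) * X 5 := by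
      rw [hF0, hF1]; simp only [map_ofNat]; ring
    rw [e]
    exact sub_mem (sub_mem (sub_mem (sub_mem (sub_mem hF1J hF0J) (J.mul_mem_left _ hX2)) (J.mul_mem_left _ hX3))
      (J.mul_mem_left _ hX4)) (J.mul_mem_left _ hX5)
  have hX0 : (X 0 : MvPolynomial (Fin 6) k) ^ 2 ∈ J := by
    have e : (X 0 : MvPolynomial (Fin 6) k) ^ 2 = F 0 - X 1 ^ 3 - X 2 ^ 4 * X 2 - X 3 ^ 4 * X 3 - X 4 ^ 6 * X 4 - X 5 ^ 6 * X 5 := by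
      rw [hF0]; ring
    rw [e]
    exact sub_mem (sub_mem (sub_mem (sub_mem (sub_mem hF0J hX1) (J.mul_mem_left _ hX2)) (J.mul_mem_left _ hX3))
      (J.mul_mem_left _ hX4)) (J.mul_mem_left _ hX5)
  -- every monomial of degree 4 lies in `J`
  rw [show Ideal.span (Set.range (X : Fin 6 → MvPolynomial (Fin 6) k)) = idealOfVars (Fin 6) k from rfl, pow_idealOfVars_eq_span,
    Ideal.span_le]
  rintro _ ⟨m, hm, rfl⟩
  rw [Set.mem_preimage, Set.mem_singleton_iff, Finsupp.degree_eq_sum, Fin.sum_univ_six] at hm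
  change monomial m (1 : k) ∈ J
  by_cases h2 : 1 ≤ m 2
  · exact DiagonalBPCIVertexNotFull.monomial_mem_of_le k 2 1 m h2 (by rw [pow_one]; exact hX2)
  by_cases h3 : 1 ≤ m 3
  · exact DiagonalBPCIVertexNotFull.monomial_mem_of_le k 3 1 m h3 (by rw [pow_one]; exact hX3)
  by_cases h4 : 1 ≤ m 4
  · exact DiagonalBPCIVertexNotFull.monomial_mem_of_le k 4 1 m h4 (by rw [pow_one]; exact hX4)
  by_cases h5 : 1 ≤ m 5
  · exact DiagonalBPCIVertexNotFull.monomial_mem_of_le k 5 1 m h5 (by rw [pow_one]; exact hX5)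
  by_cases h0 : 2 ≤ m 0
  · exact DiagonalBPCIVertexNotFull.monomial_mem_of_le k 0 2 m h0 hX0
  · exact DiagonalBPCIVertexNotFull.monomial_mem_of_le k 1 3 m (by omega) hX1

end Fedder

/-- ★ **BED CI-3, INPUT COLUMN, p-UNIFORM: the vertex of `V(F₀, F₁) ⊂ 𝔸⁶` is NOT a FULL point — for EVERY prime `p` and EVERY field `k` of characteristic `p`** (CI Fedder necessity with
the minimal-weight certificate `prod_pow_mem_span_X_pow`, expected dimension by `sop_certificate`; ONE application of ✓`CINotFullAtMaximalIdeal.ci_not_fullCl_stalk_origin`). Primality not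
used. [OURS · census certificate (input side of ROW #13); cite: Fedder1983, Thm. 1.12 and Prop. 2.1] -/
theorem twoRatioBP_vertex_not_full (p : ℕ) [Fact p.Prime] (k : Type) [Field k] [CharP k p]
    (F : Fin 2 → MvPolynomial (Fin 6) k)
    (hF0 : F 0 = X 0 ^ 2 + X 1 ^ 3 + X 2 ^ 5 + X 3 ^ 5 + X 4 ^ 7 + X 5 ^ 7)
    (hF1 : F 1 = X 0 ^ 2 + C 2 * X 1 ^ 3 + X 2 ^ 10 + X 3 ^ 10 + X 4 ^ 14 + X 5 ^ 14)
    (v : Spec (.of (MvPolynomial (Fin 6) k ⧸ Ideal.span (Set.range F))))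
    (hvm : v.asIdeal = Ideal.span (Set.range fun j : Fin 6 => Ideal.Quotient.mk (Ideal.span (Set.range F)) (X j))) :
    ¬ FullCl p ((Spec (.of (MvPolynomial (Fin 6) k ⧸ Ideal.span (Set.range F)))).presheaf.stalk v) := by
  have hfed : (∏ l, F l) ^ (p - 1) ∈ Ideal.span (Set.range fun i : Fin 6 => (X i : MvPolynomial (Fin 6) k) ^ p) := by
    rw [Fin.prod_univ_two]
    exact prod_pow_mem_span_X_pow k F hF0 hF1 p (Fact.out : p.Prime).two_le
  exact CINotFullAtMaximalIdeal.ci_not_fullCl_stalk_origin p k F (TwoRatioBPChart5NotFull.constantCoeff_F k F hF0 hF1) hfed [X 2, X 3, X 4, X 5]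
    (by simp [constantCoeff_X]) rfl 4 (sop_certificate k F hF0 hF1) v hvm

/-! ## §5 ★★★ The registrar pairing for BED CI-3 -/

/-- ★★★ **ROW #13 / BED CI-3 (unequal supports, dimension 4), `p ≥ 11`, ANY field**: the vertex is NOT FULL, AND the point floor is CURED (`K := AlgebraicClosure k`).
[OURS · assembly of landed theorems] -/
theorem row13_CI3_germ (p : ℕ) [Fact p.Prime] (hp : 11 ≤ p) (k : Type) [Field k] [CharP k p]
    (F : Fin 2 → MvPolynomial (Fin 6) k)
    (hF0 : F 0 = X 0 ^ 2 + X 1 ^ 3 + X 2 ^ 5 + X 3 ^ 5 + X 4 ^ 7 + X 5 ^ 7)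
    (hF1 : F 1 = X 0 ^ 2 + C 2 * X 1 ^ 3 + X 2 ^ 10 + X 3 ^ 10 + X 4 ^ 14 + X 5 ^ 14)
    (v : Spec (.of (MvPolynomial (Fin 6) k ⧸ Ideal.span (Set.range F))))
    (hvm : v.asIdeal = Ideal.span (Set.range fun j : Fin 6 => Ideal.Quotient.mk (Ideal.span (Set.range F)) (X j))) :
    ¬ FullCl p ((Spec (.of (MvPolynomial (Fin 6) k ⧸ Ideal.span (Set.range F)))).presheaf.stalk v) ∧
    ∀ (S' : Scheme.{0}) (gS : S' ⟶ Spec ((Spec (.of (MvPolynomial (Fin 6) k ⧸ Ideal.span (Set.range F)))).presheaf.stalk v)),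
      IsBlowup gS ((affineBlowup.idealSheaf (Ideal.span (Set.range fun j : Fin 6 => Ideal.Quotient.mk (Ideal.span (Set.range F)) (X j)))).comap
        ((Spec (.of (MvPolynomial (Fin 6) k ⧸ Ideal.span (Set.range F)))).fromSpecStalk v)) →
      ∃ 𝓚 : S'.IdealSheafData, 𝓚 ≠ ⊥ ∧
        (∀ s ∈ (𝓚.support : Set S'), gS.base s = closedPoint ((Spec (.of (MvPolynomial (Fin 6) k ⧸ Ideal.span (Set.range F)))).presheaf.stalk v)) ∧
        ∀ (S'' : Scheme.{0}) (π : S'' ⟶ S'), IsBlowup π 𝓚 → ∀ s : S'', FullCl p (S''.presheaf.stalk s) :=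
  ⟨twoRatioBP_vertex_not_full p k F hF0 hF1 v hvm, twoRatioBP_pointFloorCured p hp k (AlgebraicClosure k) F hF0 hF1 v hvm⟩

end Summit.ResolutionOfSingularities.ResolutionOfSingularities.Theorems.FInjectiveMacaulayfication.TwoRatioBPCIRow

end
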